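import Literature.NumberTheory.Automorphic.EichlerEmbeddingLocalGlobal
import Mathlib.GroupTheory.Index
import HarnessLib

/-!
# The class numbers of two quadratic orders: `h(B) [B'ˣ : Bˣ] = h(B') ∏_p [B'_(p)ˣ : B_(p)ˣ]`
# (idelic form of Dedekind's index formula, Vignéras III §5, Cox Thm. 7.24)

Topic `NumberTheory/Automorphic`; auxiliary definitions with bodies (`unitIdelesAt`, the unit
ideles of an order `B` read in the idele group of a larger order `B'`; `commUnits γ = ℚ(γ)ˣ`;
`constHom`, the diagonal embedding), otherwise theorems; no named fact, no `sorry`. Sixth brick of the Brandt-module side of the Eichler–Pizer trace identity.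

For orders `B ⊆ B'` of the quadratic algebra `ℚ(γ)` inside a division quaternion algebra `D`
(`IsQuadOrder γ B`, `IsQuadOrder γ B'`), with the idelic class numbers
`h(B) = classNumber γ B = #(ℚ(γ)ˣ \ 𝔸ˣ / ∏_p B_(p)ˣ)` of `EichlerEmbeddingLocalGlobal.lean`:

* `classNumber_mul_relIndex_eq` —
  `h(B) · [B'ˣ : Bˣ] = h(B') · ∏_{p ∈ S} [B'_(p)ˣ : B_(p)ˣ]`
  for every finite set `S` of primes containing those where `B_(p) ≠ B'_(p)`; here
  `Bˣ = stabCentralizer B γ`, `B_(p)ˣ = stabCentralizer B_(p) γ` (units of `ℚ(γ)` stabilising the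
  lattice) and the indices are `Subgroup.relIndex`.

## Proof (group theory in the commutative idele group)

The idele groups of `B` and `B'` coincide (`ideleGroup_eq`); inside this commutative group `Γ`,
with `P` the principal ideles, `U ≤ U'` the unit ideles of `B`, `B'`:
`h(B) = [Γ : P U]`, `h(B') = [Γ : P U']` (`classNumber_eq_index`), so `h(B) = [PU' : PU] h(B')`,
and `[U' : U] = [U' : U (P ∩ U')] [U (P ∩ U') : U] = [PU' : PU] [P ∩ U' : P ∩ U]`
(Dedekind's modular law and the second isomorphism theorem), whence
`h(B) [P ∩ U' : P ∩ U] = h(B') [U' : U]`. Finally `P ∩ U' ≅ B'ˣ`, `P ∩ U ≅ Bˣ` (a unit of `ℚ(γ)`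
stabilising every `B_(p)` stabilises `B`, local–global principle), and
`U'/U ≅ ∏_{p ∈ S} B'_(p)ˣ / B_(p)ˣ` (ideles may be prescribed at finitely many places).

## References

* M.-F. Vignéras, *Arithmétique des algèbres de quaternions*, LNM 800 (1980), Ch. III §5
  (proof of Thm. 5.11; Cor. 5.12) [VignerasLNM800].
* D. A. Cox, *Primes of the form x² + ny²*, 2nd ed. (2013), Thm. 7.24 and its proof
  (exact sequence (7.25)–(7.27)) [Cox2013].
-/

noncomputable section

open scoped Pointwise

universe u

namespace Literature.NumberTheory.Automorphic

namespace Brandt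

variable {D : Type u} [Ring D] [Algebra ℚ D] [IsQuaternionAlgebra ℚ D] {γ : D} {B B' : Submodule ℤ D}

/-! ### Commutativity inside `ℚ(γ)ˣ` -/

/-- Two units commuting with `γ` commute (`ℚ(γ)` is commutative). [folklore] -/
theorem mul_comm_of_comm (hD : ∀ x : D, x ≠ 0 → IsUnit x) (hγ : γ ∉ (⊥ : Subalgebra ℚ D))
    {a b : D} (ha : a * γ = γ * a) (hb : b * γ = γ * b) : a * b = b * a :=
  (Algebra.commute_of_mem_adjoin_singleton_of_commute
    ((mul_eq_mul_iff_mem_adjoin hD hγ).mp hb) ha :)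

/-- The idele group is commutative. [folklore] -/
theorem ideleGroup_mul_comm (hD : ∀ x : D, x ≠ 0 → IsUnit x) (hγ : γ ∉ (⊥ : Subalgebra ℚ D))
    (k k' : ideleGroup γ B) : k * k' = k' * k := by
  apply Subtype.ext
  funext p
  rw [Subgroup.coe_mul, Subgroup.coe_mul, Pi.mul_apply, Pi.mul_apply]
  exact Units.ext (mul_comm_of_comm hD hγ (k.2.1 p) (k'.2.1 p))

/-- Every subgroup of the idele group is normal. [folklore] -/
theorem normal_of_ideleGroup (hD : ∀ x : D, x ≠ 0 → IsUnit x) (hγ : γ ∉ (⊥ : Subalgebra ℚ D))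
    (H : Subgroup (ideleGroup γ B)) : H.Normal :=
  ⟨fun n hn g => by rwa [ideleGroup_mul_comm hD hγ g n, mul_inv_cancel_right]⟩

/-! ### The idele groups of two orders through `γ` coincide -/

omit [IsQuaternionAlgebra ℚ D] in
/-- `B_(p)ˣ ⊆ B'_(p)ˣ` for `B ⊆ B'`. [folklore] -/
theorem stabCentralizer_localAt_mono (hB : IsQuadOrder γ B) (hB' : IsQuadOrder γ B') (hle : B ≤ B') (p : ℕ) :
    stabCentralizer (localAt p B) γ ≤ stabCentralizer (localAt p B') γ := by
  intro u hu
  obtain ⟨huB, huγ⟩ := hu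
  have h := (MulAction.mem_stabilizer_iff.mpr huB :)
  rw [mem_stabilizer_iff_mem_leftOrder, IsQuadOrder.leftOrder_localAt_eq hB.one_mem hB.mul_mem] at h
  refine ⟨?_, huγ⟩
  rw [← MulAction.mem_stabilizer_iff, mem_stabilizer_iff_mem_leftOrder,
    IsQuadOrder.leftOrder_localAt_eq hB'.one_mem hB'.mul_mem]
  exact ⟨localAt_mono p hle h.1, localAt_mono p hle h.2⟩

omit [IsQuaternionAlgebra ℚ D] in
/-- `Bˣ ⊆ B'ˣ` for `B ⊆ B'`. [folklore] -/
theorem stabCentralizer_mono (hB : IsQuadOrder γ B) (hB' : IsQuadOrder γ B') (hle : B ≤ B') :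
    stabCentralizer B γ ≤ stabCentralizer B' γ := by
  intro u hu
  obtain ⟨huB, huγ⟩ := hu
  have h := (MulAction.mem_stabilizer_iff.mpr huB :)
  rw [mem_stabilizer_iff_mem_leftOrder, leftOrder_eq_self_of_one_mem hB.one_mem hB.mul_mem] at h
  refine ⟨?_, huγ⟩
  rw [← MulAction.mem_stabilizer_iff, mem_stabilizer_iff_mem_leftOrder,
    leftOrder_eq_self_of_one_mem hB'.one_mem hB'.mul_mem]
  exact ⟨hle h.1, hle h.2⟩

omit [IsQuaternionAlgebra ℚ D] in
/-- **The idele groups of `B` and `B'` coincide** (they differ at finitely many places only). [folklore] -/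
theorem ideleGroup_eq (hB : IsQuadOrder γ B) (hB' : IsQuadOrder γ B') : ideleGroup γ B = ideleGroup γ B' := by
  have key : ∀ {B B' : Submodule ℤ D}, IsQuadOrder γ B → IsQuadOrder γ B' → ideleGroup γ B ≤ ideleGroup γ B' := by
    intro B B' hB hB' k hk
    refine ⟨hk.1, ((hB.finite_setOf_localAt_ne hB').union hk.2).subset ?_⟩
    rintro p ⟨hp, hkp⟩
    by_cases h : localAt p B = localAt p B'
    · exact Or.inr ⟨hp, by rwa [h]⟩
    · exact Or.inl ⟨hp, h⟩
  exact le_antisymm (key hB hB') (key hB' hB)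

/-! ### Unit ideles of `B` inside the idele group of `B'`; principal ideles -/

omit [IsQuaternionAlgebra ℚ D] [Algebra ℚ D] in
/-- **The unit ideles `∏_p B_(p)ˣ` of an order `B`, read inside the idele group of `B'`.** [cite: VignerasLNM800, Ch. III §5 Thm. 5.11 (proof)] -/
def unitIdelesAt (γ : D) (B' B : Submodule ℤ D) : Subgroup (ideleGroup γ B') where
  carrier := {k | ∀ p : ℕ, p.Prime → (k : ℕ → Dˣ) p ∈ stabCentralizer (localAt p B) γ}
  one_mem' p _ := by exact Subgroup.one_mem _
  mul_mem' ha hb p hp := by exact Subgroup.mul_mem _ (ha p hp) (hb p hp)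
  inv_mem' ha p hp := by exact Subgroup.inv_mem _ (ha p hp)

omit [IsQuaternionAlgebra ℚ D] [Algebra ℚ D] in
/-- Membership in `unitIdelesAt` (definitional). [folklore] -/
theorem mem_unitIdelesAt_iff {k : ideleGroup γ B'} :
    k ∈ unitIdelesAt γ B' B ↔ ∀ p : ℕ, p.Prime → (k : ℕ → Dˣ) p ∈ stabCentralizer (localAt p B) γ :=
  Iff.rfl

omit [IsQuaternionAlgebra ℚ D] [Algebra ℚ D] in
/-- `unitIdelesAt γ B' B' = unitIdeles γ B'`. [folklore] -/
theorem unitIdelesAt_self : unitIdelesAt γ B' B' = unitIdeles γ B' := rfl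

omit [IsQuaternionAlgebra ℚ D] in
/-- `∏ B_(p)ˣ ≤ ∏ B'_(p)ˣ`. [folklore] -/
theorem unitIdelesAt_mono (hB : IsQuadOrder γ B) (hB' : IsQuadOrder γ B') (hle : B ≤ B') :
    unitIdelesAt γ B' B ≤ unitIdelesAt γ B' B' := fun _ hk p hp =>
  stabCentralizer_localAt_mono hB hB' hle p (hk p hp)

omit [IsQuaternionAlgebra ℚ D] [Algebra ℚ D] in
/-- A principal idele is constant with a value commuting with `γ`. [folklore] -/
theorem exists_const_of_mem_principalIdeles {k : ideleGroup γ B'} (hk : k ∈ principalIdeles γ B') :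
    ∃ c : Dˣ, (c : D) * γ = γ * c ∧ ∀ p, (k : ℕ → Dˣ) p = c := by
  obtain ⟨c, hc⟩ := hk
  exact ⟨c, by rw [← hc 0]; exact k.2.1 0, hc⟩

/-! ### The class number as an index -/

/-- **`h(B) = [Γ : P · ∏_p B_(p)ˣ]`**: the idele classes of `B` are the cosets of
`P U_B` in the (common) idele group `Γ`. [cite: VignerasLNM800, Ch. III §5 Thm. 5.11 (proof, (1))] -/
theorem classNumber_eq_index (hD : ∀ x : D, x ≠ 0 → IsUnit x) (hγ : γ ∉ (⊥ : Subalgebra ℚ D))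
    (hB : IsQuadOrder γ B) (hB' : IsQuadOrder γ B') :
    classNumber γ B = (principalIdeles γ B' ⊔ unitIdelesAt γ B' B).index := by
  have hG : ideleGroup γ B = ideleGroup γ B' := ideleGroup_eq hB hB'
  haveI := normal_of_ideleGroup (B := B') hD hγ (unitIdelesAt γ B' B)
  let e : ideleGroup γ B ≃ ideleGroup γ B' := (MulEquiv.subgroupCongr hG).toEquiv
  rw [classNumber, Subgroup.index, IdeleClass]
  refine Nat.card_congr (Quotient.congr e fun k k' => ?_)
  rw [QuotientGroup.leftRel_apply, Subgroup.mem_sup_of_normal_right]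
  change (∃ c : Dˣ, ∃ u : ideleGroup γ B, (c : D) * γ = γ * c ∧ u ∈ unitIdeles γ B ∧
    (k' : ℕ → Dˣ) = (fun _ : ℕ => c) * (k : ℕ → Dˣ) * (u : ℕ → Dˣ)) ↔ _
  constructor
  · rintro ⟨c, u, hc, hu, h⟩
    refine ⟨constIdele hD hγ hB' c hc, constIdele_mem_principalIdeles hD hγ hB' c hc, e u,
      fun p hp => hu p hp, ?_⟩
    apply Subtype.ext
    funext p
    have h' : (k' : ℕ → Dˣ) p = c * (k : ℕ → Dˣ) p * (u : ℕ → Dˣ) p := by rw [h]; rfl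
    have hcomm : c * (k : ℕ → Dˣ) p = (k : ℕ → Dˣ) p * c :=
      Units.ext (mul_comm_of_comm hD hγ hc (k.2.1 p))
    change c * (u : ℕ → Dˣ) p = ((k : ℕ → Dˣ) p)⁻¹ * (k' : ℕ → Dˣ) p
    rw [h', hcomm, mul_assoc, inv_mul_cancel_left]
  · rintro ⟨y, hy, z, hz, hyz⟩
    obtain ⟨c, hc, hyc⟩ := exists_const_of_mem_principalIdeles hy
    refine ⟨c, e.symm z, hc, fun p hp => hz p hp, ?_⟩
    funext p
    have h' : c * (z : ℕ → Dˣ) p = ((k : ℕ → Dˣ) p)⁻¹ * (k' : ℕ → Dˣ) p := by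
      have := congrArg (fun w : ideleGroup γ B' => (w : ℕ → Dˣ) p) hyz
      simp only [Subgroup.coe_mul, Pi.mul_apply, hyc] at this
      exact this
    have hcomm : c * (k : ℕ → Dˣ) p = (k : ℕ → Dˣ) p * c :=
      Units.ext (mul_comm_of_comm hD hγ hc (k.2.1 p))
    change (k' : ℕ → Dˣ) p = c * (k : ℕ → Dˣ) p * (z : ℕ → Dˣ) p
    rw [hcomm, mul_assoc, h', mul_inv_cancel_left]

/-! ### Group theory: `[Γ : PU] [P ∩ U' : P ∩ U] = [Γ : PU'] [U' : U]` -/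

/-- In a group all of whose subgroups are normal, for subgroups `P` and `U ≤ U'`:
`[Γ : P U] · [P ∩ U' : P ∩ U] = [Γ : P U'] · [U' : U]` (modular law and second isomorphism
theorem). [cite: Cox2013, Thm. 7.24 (proof, (7.27))] -/
theorem index_sup_mul_relIndex_inf {Γ : Type*} [Group Γ] (P U U' : Subgroup Γ) (hUU' : U ≤ U')
    (hn : ∀ H : Subgroup Γ, H.Normal) :
    (P ⊔ U).index * (P ⊓ U).relIndex (P ⊓ U') = (P ⊔ U').index * U.relIndex U' := by
  haveI := hn (P ⊔ U)
  haveI := hn U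
  haveI := hn P
  haveI := hn U'
  haveI := hn (P ⊓ U')
  have h1 : (P ⊔ U).index = (P ⊔ U).relIndex (P ⊔ U') * (P ⊔ U').index :=
    (Subgroup.relIndex_mul_index (sup_le_sup_left hUU' P)).symm
  have hmod : (P ⊔ U) ⊓ U' = U ⊔ (P ⊓ U') := by
    apply SetLike.coe_injective
    rw [Subgroup.coe_inf, Subgroup.mul_normal U (P ⊓ U'), Subgroup.mul_inf_assoc U P U' hUU',
      ← Subgroup.mul_normal U P, sup_comm U P]
  have h2 : U.relIndex U' = U.relIndex (U ⊔ (P ⊓ U')) * (U ⊔ (P ⊓ U')).relIndex U' :=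
    (Subgroup.relIndex_mul_relIndex U (U ⊔ (P ⊓ U')) U' le_sup_left (sup_le hUU' inf_le_right)).symm
  have h3 : U.relIndex (U ⊔ (P ⊓ U')) = (P ⊓ U).relIndex (P ⊓ U') := by
    rw [Subgroup.relIndex_sup_left, ← Subgroup.inf_relIndex_right]
    congr 1
    apply le_antisymm
    · exact le_inf (inf_le_right.trans inf_le_left) inf_le_left
    · exact le_inf inf_le_right (le_inf inf_le_left (inf_le_right.trans hUU'))
  have h4 : (U ⊔ (P ⊓ U')).relIndex U' = (P ⊔ U).relIndex (P ⊔ U') := by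
    rw [← hmod, Subgroup.inf_relIndex_right,
      show P ⊔ U' = U' ⊔ (P ⊔ U) by rw [sup_left_comm, sup_eq_left.mpr hUU'],
      Subgroup.relIndex_sup_right]
  rw [h1, h2, h3, h4]
  ring

/-! ### `P ∩ U ≅ Bˣ`: global units -/

omit [IsQuaternionAlgebra ℚ D] [Algebra ℚ D] in
/-- The units of `D` commuting with `γ` (the group `ℚ(γ)ˣ`). [folklore] -/
def commUnits (γ : D) : Subgroup Dˣ where
  carrier := {c | (c : D) * γ = γ * c}
  one_mem' := by simp
  mul_mem' {a b} ha hb := by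
    change (a : D) * b * γ = γ * (a * b)
    rw [mul_assoc, hb, ← mul_assoc, ha, mul_assoc]
  inv_mem' {a} ha := units_inv_comm ha

omit [IsQuaternionAlgebra ℚ D] [Algebra ℚ D] in
/-- Membership in `commUnits` (definitional). [folklore] -/
theorem mem_commUnits_iff {c : Dˣ} : c ∈ commUnits γ ↔ (c : D) * γ = γ * c := Iff.rfl

omit [IsQuaternionAlgebra ℚ D] [Algebra ℚ D] in
/-- `stabCentralizer J γ ≤ commUnits γ`. [folklore] -/
theorem stabCentralizer_le_commUnits (J : Submodule ℤ D) : stabCentralizer J γ ≤ commUnits γ :=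
  fun _ hc => hc.2

/-- **The diagonal embedding `ℚ(γ)ˣ → Γ`** (constant ideles). [cite: VignerasLNM800, Ch. III §5 Thm. 5.11 (proof)] -/
def constHom (hD : ∀ x : D, x ≠ 0 → IsUnit x) (hγ : γ ∉ (⊥ : Subalgebra ℚ D))
    (hB' : IsQuadOrder γ B') : commUnits γ →* ideleGroup γ B' where
  toFun c := constIdele hD hγ hB' c c.2
  map_one' := Subtype.ext (funext fun _ => rfl)
  map_mul' _ _ := Subtype.ext (funext fun _ => rfl)

/-- The value of a constant idele. [folklore] -/
theorem constHom_apply (hD : ∀ x : D, x ≠ 0 → IsUnit x) (hγ : γ ∉ (⊥ : Subalgebra ℚ D))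
    (hB' : IsQuadOrder γ B') (c : commUnits γ) (p : ℕ) :
    ((constHom hD hγ hB' c : ideleGroup γ B') : ℕ → Dˣ) p = c := rfl

/-- The diagonal embedding is injective. [folklore] -/
theorem constHom_injective (hD : ∀ x : D, x ≠ 0 → IsUnit x) (hγ : γ ∉ (⊥ : Subalgebra ℚ D))
    (hB' : IsQuadOrder γ B') : Function.Injective (constHom hD hγ hB') := fun _ _ h =>
  Subtype.ext (congrFun (congrArg (fun k : ideleGroup γ B' => (k : ℕ → Dˣ)) h) 0)

omit [Algebra ℚ D] [IsQuaternionAlgebra ℚ D] in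
/-- **Local–global principle for units**: a unit of `ℚ(γ)` stabilises `B` iff it stabilises every
`B_(p)`. [cite: VignerasLNM800, Ch. III §5 Prop. 5.1] -/
theorem mem_stabCentralizer_iff_forall_localAt {c : Dˣ} (hc : (c : D) * γ = γ * c) :
    c ∈ stabCentralizer B γ ↔ ∀ p : ℕ, p.Prime → c ∈ stabCentralizer (localAt p B) γ := by
  simp only [mem_stabCentralizer_iff]
  constructor
  · intro h p _
    exact ⟨by rw [← localAt_units_smul, h.1], hc⟩
  · intro h
    refine ⟨eq_iff_forall_prime_localAt_eq.mpr fun p hp => ?_, hc⟩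
    rw [localAt_units_smul]
    exact (h p hp).1

/-- **`P ∩ ∏_p B_(p)ˣ` is the image of `Bˣ`** under the diagonal embedding. [cite: VignerasLNM800, Ch. III §5 Thm. 5.11 (proof)] -/
theorem principalIdeles_inf_unitIdelesAt_eq (hD : ∀ x : D, x ≠ 0 → IsUnit x)
    (hγ : γ ∉ (⊥ : Subalgebra ℚ D)) (hB' : IsQuadOrder γ B') (B : Submodule ℤ D) :
    principalIdeles γ B' ⊓ unitIdelesAt γ B' B =
      ((stabCentralizer B γ).subgroupOf (commUnits γ)).map (constHom hD hγ hB') := by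
  ext k
  rw [Subgroup.mem_inf, Subgroup.mem_map]
  constructor
  · rintro ⟨hk, hkU⟩
    obtain ⟨c, hc, hkc⟩ := exists_const_of_mem_principalIdeles hk
    refine ⟨⟨c, hc⟩, ?_, ?_⟩
    · rw [Subgroup.mem_subgroupOf]
      exact (mem_stabCentralizer_iff_forall_localAt hc).mpr fun p hp => hkc p ▸ hkU p hp
    · exact Subtype.ext (funext fun p => (hkc p).symm)
  · rintro ⟨c, hc, rfl⟩
    rw [Subgroup.mem_subgroupOf] at hc
    exact ⟨⟨c, fun _ => rfl⟩, fun p hp => (mem_stabCentralizer_iff_forall_localAt c.2).mp hc p hp⟩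

/-- **`[P ∩ U' : P ∩ U] = [B'ˣ : Bˣ]`.** [cite: Cox2013, Thm. 7.24 (proof)] -/
theorem relIndex_principalIdeles_inf (hD : ∀ x : D, x ≠ 0 → IsUnit x)
    (hγ : γ ∉ (⊥ : Subalgebra ℚ D)) (hB' : IsQuadOrder γ B') (B : Submodule ℤ D) :
    (principalIdeles γ B' ⊓ unitIdelesAt γ B' B).relIndex (principalIdeles γ B' ⊓ unitIdelesAt γ B' B') =
      (stabCentralizer B γ).relIndex (stabCentralizer B' γ) := by
  rw [principalIdeles_inf_unitIdelesAt_eq hD hγ hB' B, principalIdeles_inf_unitIdelesAt_eq hD hγ hB' B',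
    Subgroup.relIndex_map_map_of_injective _ _ (constHom_injective hD hγ hB'),
    Subgroup.relIndex_subgroupOf (stabCentralizer_le_commUnits B')]

/-! ### `U'/U ≅ ∏_{p ∈ S} B'_(p)ˣ / B_(p)ˣ` -/

omit [Algebra ℚ D] [IsQuaternionAlgebra ℚ D] in
/-- **`[∏ B'_(p)ˣ : ∏ B_(p)ˣ] = ∏_{p ∈ S} [B'_(p)ˣ : B_(p)ˣ]`** for a finite set `S` of primes
containing those where `B_(p) ≠ B'_(p)` (ideles may be prescribed arbitrarily at finitely many
places). [cite: VignerasLNM800, Ch. III §5 Thm. 5.11 (proof); Cox2013, Thm. 7.24 (proof, (7.26))] -/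
theorem relIndex_unitIdelesAt_eq_prod (S : Finset ℕ) (hS : ∀ p ∈ S, p.Prime)
    (hSB : ∀ p : ℕ, p.Prime → p ∉ S → localAt p B = localAt p B') :
    (unitIdelesAt γ B' B).relIndex (unitIdelesAt γ B' B') =
      ∏ p ∈ S, (stabCentralizer (localAt p B) γ).relIndex (stabCentralizer (localAt p B') γ) := by
  classical
  set U := unitIdelesAt γ B' B with hU
  set U' := unitIdelesAt γ B' B' with hU'
  -- the quotient `U'/U` and the local quotients, as coset spaces
  let Q : S → Type u := fun p =>
    stabCentralizer (localAt (p : ℕ) B') γ ⧸ (stabCentralizer (localAt (p : ℕ) B) γ).subgroupOf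
      (stabCentralizer (localAt (p : ℕ) B') γ)
  -- the component maps
  have hcomp : ∀ (k : U') (p : S), ((k : ideleGroup γ B') : ℕ → Dˣ) p ∈ stabCentralizer (localAt (p : ℕ) B') γ :=
    fun k p => k.2 p (hS p p.2)
  let φ : U' → ∀ p : S, Q p := fun k p => QuotientGroup.mk ⟨_, hcomp k p⟩
  have hφ : ∀ k k' : U', (QuotientGroup.leftRel (U.subgroupOf U')) k k' ↔ φ k = φ k' := by
    intro k k'
    rw [QuotientGroup.leftRel_apply, Subgroup.mem_subgroupOf]
    constructor
    · intro h
      funext p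
      apply QuotientGroup.eq.mpr
      rw [Subgroup.mem_subgroupOf]
      exact h p (hS p p.2)
    · intro h p hp
      by_cases hpS : p ∈ S
      · have := congrFun h ⟨p, hpS⟩
        change (QuotientGroup.mk _ : Q ⟨p, hpS⟩) = QuotientGroup.mk _ at this
        rw [QuotientGroup.eq, Subgroup.mem_subgroupOf] at this
        exact this
      · rw [hSB p hp hpS]
        exact Subgroup.mul_mem _ (Subgroup.inv_mem _ (k.2 p hp)) (k'.2 p hp)
  -- the induced map on `U'/U` is a bijection
  let Φ : (U' ⧸ U.subgroupOf U') → ∀ p : S, Q p := Quotient.lift φ fun k k' h => (hφ k k').mp h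
  have hΦinj : Function.Injective Φ := by
    intro x y hxy
    induction x using Quotient.inductionOn
    induction y using Quotient.inductionOn
    exact Quotient.sound ((hφ _ _).mpr hxy)
  have hΦsurj : Function.Surjective Φ := by
    intro c
    -- representatives of the local classes, `1` outside `S`
    let k₀ : ℕ → Dˣ := fun q => if hq : q ∈ S then ((c ⟨q, hq⟩).out : Dˣ) else 1
    have hk₀ : ∀ q, k₀ q ∈ stabCentralizer (localAt q B') γ := by
      intro q
      by_cases hq : q ∈ S
      · simp only [k₀, dif_pos hq]; exact ((c ⟨q, hq⟩).out).2
      · simp only [k₀, dif_neg hq]; exact Subgroup.one_mem _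
    have hk₀G : k₀ ∈ ideleGroup γ B' :=
      ⟨fun q => (hk₀ q).2, Set.finite_empty.subset fun q ⟨_, hq⟩ => hq (hk₀ q)⟩
    refine ⟨Quotient.mk _ ⟨⟨k₀, hk₀G⟩, fun q _ => hk₀ q⟩, ?_⟩
    change φ _ = c
    funext p
    have hp : k₀ p = ((c p).out : Dˣ) := by simp only [k₀, dif_pos p.2]
    change (QuotientGroup.mk ⟨k₀ p, _⟩ : Q p) = c p
    conv_rhs => rw [← (c p).out_eq]
    congr 1
    exact Subtype.ext hp
  rw [Subgroup.relIndex, Subgroup.index, Nat.card_congr (Equiv.ofBijective Φ ⟨hΦinj, hΦsurj⟩), Nat.card_pi,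
    ← Finset.prod_coe_sort S]
  exact Finset.prod_congr rfl fun p _ => rfl

/-! ### The index formula -/

/-- **The class numbers of two orders `B ⊆ B'` of `ℚ(γ)`**:
`h(B) · [B'ˣ : Bˣ] = h(B') · ∏_{p ∈ S} [B'_(p)ˣ : B_(p)ˣ]` for any finite set `S` of primes
outside which `B_(p) = B'_(p)` — the idelic form of Dedekind's formula
`h(𝒪) = h(𝒪_K) f ∏_{p ∣ f} (1 - (d_K/p)/p) / [𝒪_Kˣ : 𝒪ˣ]` (Cox Thm. 7.24), before the local
indices are evaluated. [cite: VignerasLNM800, Ch. III §5 Cor. 5.12; Cox2013, Thm. 7.24] -/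
theorem classNumber_mul_relIndex_eq (hD : ∀ x : D, x ≠ 0 → IsUnit x) (hγ : γ ∉ (⊥ : Subalgebra ℚ D))
    (hB : IsQuadOrder γ B) (hB' : IsQuadOrder γ B') (hle : B ≤ B') (S : Finset ℕ)
    (hS : ∀ p ∈ S, p.Prime) (hSB : ∀ p : ℕ, p.Prime → p ∉ S → localAt p B = localAt p B') :
    classNumber γ B * (stabCentralizer B γ).relIndex (stabCentralizer B' γ) =
      classNumber γ B' *
        ∏ p ∈ S, (stabCentralizer (localAt p B) γ).relIndex (stabCentralizer (localAt p B') γ) := by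
  rw [classNumber_eq_index hD hγ hB hB', classNumber_eq_index hD hγ hB' hB',
    ← relIndex_principalIdeles_inf hD hγ hB' B, ← relIndex_unitIdelesAt_eq_prod S hS hSB]
  exact index_sup_mul_relIndex_inf _ _ _ (unitIdelesAt_mono hB hB' hle) (normal_of_ideleGroup hD hγ)

end Brandt

end Literature.NumberTheory.Automorphic

end
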